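import Summits.PneNP.PneNP.Theorems.ReslinSizeFromWidthQuadraticInduction
import Summits.PneNP.PneNP.Theorems.ReslinSizeFromWidthQuadraticClauses
import Summits.PneNP.PneNP.Theorems.ReslinSizeFromWidthRandomThreeCnfResLinRank

/-!
# PneNP / ReslinSizeFromWidth — the QUADRATIC SIZE–WIDTH LAW for Res(⊕) (supports crux
`ResLinSizeFromWidth`, stmt-PneNP-18932)

Route `PneNP/ReslinSizeFromWidth`.  The crux X1 = `ResLinSizeFromWidth` (rank `≥ N/m` for all
dag-like Res(⊕) refutations — Itsykson–Sokolov's system with SEMANTIC weakening — of a width-`≤ t`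
CNF ⇒ every refutation longer than `N^C`, for every `C`) is open; this file proves its QUADRATIC
TRUNCATION, formula-free: `ResLinSW.B_le_length_of_isResLinRefutation` — if every Res(⊕) refutation
of `φ` (clause width `≤ t`) has `resLinWidth ≥ k`, then every Res(⊕) refutation of `φ` has at least
`B t (k-1) = 1 + Σ_{s=t+1}^{k-1} s` lines; corollaries `resLinSizeFromWidth_exponent_one` (X1 AT
EXPONENT `C = 1`) and `randomThreeCnf_resLinSize_quadratic` (∀ c ≥ 6 ∃ δ > 0:
`Pr_{F₃(n, cn)}[unsat ∧ every Res(⊕) refutation has ≥ δ·n² lines] → 1`).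

Proof: the semantic law `B_le_length` (helper files `ReslinSizeFromWidthQuadratic*`: cylinder
lifts, common-subspace lemma, induction on the ambient dimension) on the window of `φ` and `π`, and
the bridge back to syntax (whence `k-1`).  In print only the LIFTED case `S(φ₀∘g) ≥ w(w+1)/2`
(Itsykson–Podolskii–Shekhovtsov, CCC 2026, Thm 1.6) and `n^{2-o(1)}` for SYNTACTIC weakening
(Khaniki, ToCL 2022); the formula-free statement follows an internal unpublished manuscript (NOT a
cited fact); nothing superquadratic is claimed.  [ItsyksonSokolov2020, §2;
EfremenkoGarlikItsykson2024, §1.2; BenSassonWigderson2001, §3; ChvatalSzemeredi1988]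
-/

namespace Summit.PneNP.PneNP.Theorems

-- `Summit.PneNP.PneNP` repeats a path component by design (summit = sub-problem); silence the linter.
set_option linter.dupNamespace false

namespace ResLinSW

section Bridge

open Module Submodule Finset
open Literature.Computability.Complexity Literature.Computability.MetaComplexity
open Literature.Computability.MetaComplexity.AffSys
open Summit.PneNP.PneNP.Theorems.ResLinRank

variable (N : Finset ℕ)

/-- The axiom flats of a width-`≤ t` CNF are flats of rank `≤ t` (relative to `univ`). -/
theorem goodAxioms_axiomFlats {φ : CNF ℕ} {t : ℕ} (hφ : φ.IsWidthLE t) :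
    GoodAxioms (axiomFlats N φ) Set.univ t := by
  refine ⟨?_, ?_⟩
  · rintro F ⟨c, -, rfl⟩
    exact isFlat_falsN N _
  · rintro F ⟨c, hc, rfl⟩ hne
    rw [Set.inter_univ] at hne ⊢
    refine (codim_falsN_le N _ hne).trans ((linClauseRank_le_card _).trans ?_)
    refine le_trans ?_ (hφ c hc)
    rw [Clause.toLinClause]
    exact (List.toFinset_card_le _).trans (by simp)

/-- From a semantic derivation (nonempty flats of rank `≤ w`) of the axiom flats of `φ`: a Res(⊕)
derivation from `φ` with a line `clOf S` for every semantic line `S`, all ranks `≤ max (w+1) t`. -/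
theorem exists_derivation_of_isDeriv {φ : CNF ℕ} {t w : ℕ} (hφ : φ.IsWidthLE t)
    (hNφ : cnfVars φ ⊆ N) :
    ∀ L : List (Set (↥N → ZMod 2)), IsDeriv (axiomFlats N φ) L → (∀ S ∈ L, IsFlat S) →
      (∀ S ∈ L, S.Nonempty) → (∀ S ∈ L, codim Set.univ S ≤ w) →
      ∃ ρ : List ResLinLine, IsResLinDerivation φ ρ ∧
        (∀ S ∈ L, ∃ i, ∃ hi : i < ρ.length, (ρ[i]'hi).clause = clOf N S) ∧
        ∀ l ∈ ρ, linClauseRank l.clause ≤ max (w + 1) t := by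
  classical
  intro L
  induction L with
  | nil =>
    intro _ _ _ _
    exact ⟨[], fun k hk => absurd hk (Nat.not_lt_zero _), fun S hS => absurd hS List.not_mem_nil,
      fun l hl => absurd hl List.not_mem_nil⟩
  | cons S T ih =>
    intro hd hflat hne hrank
    obtain ⟨ρ, hρ, hidx, hrk⟩ := ih hd.2 (fun S hS => hflat S (List.mem_cons_of_mem _ hS))
      (fun S hS => hne S (List.mem_cons_of_mem _ hS)) (fun S hS => hrank S (List.mem_cons_of_mem _ hS))
    have hSflat : IsFlat S := hflat S List.mem_cons_self
    have hSrank : linClauseRank (clOf N S) ≤ w := by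
      refine (linClauseRank_le_card _).trans ((card_clOf_le N S).trans ?_)
      have := hrank S List.mem_cons_self
      rwa [codim, W_univ, finrank_bot, Nat.sub_zero] at this
    -- extend the invariant to the old lines after appending a block
    have hold : ∀ (blk : List ResLinLine), ∀ S' ∈ T, ∃ i, ∃ hi : i < (ρ ++ blk).length,
        ((ρ ++ blk)[i]'hi).clause = clOf N S' := by
      intro blk S' hS'
      obtain ⟨i, hi, hcl⟩ := hidx S' hS'
      refine ⟨i, by rw [List.length_append]; omega, ?_⟩
      rw [List.getElem_append_left hi]
      exact hcl
    cases hd.1 with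
    | ax F hF hSF =>
      obtain ⟨c, hc, rfl⟩ := hF
      -- block: [initial c, weaken → clOf S]
      let l₁ : ResLinLine := ⟨Clause.toLinClause c, .initial⟩
      let l₂ : ResLinLine := ⟨clOf N S, .weaken ρ.length⟩
      have h₁ : IsValidResLinLine φ ρ l₁ := IsValidResLinLine.of_initial rfl hc rfl
      have hρ₁ := isResLinDerivation_append_step hρ h₁
      have h₂ : IsValidResLinLine φ (ρ ++ [l₁]) l₂ := by
        refine IsValidResLinLine.of_weaken rfl (by simp) fun σ hσ => ?_
        rw [List.getElem_append_right le_rfl] at hσ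
        simp only [Nat.sub_self, List.getElem_cons_zero] at hσ
        -- c.toLinClause ⊨ clOf S since fals (clOf S) = S ⊆ fals c
        by_contra hcon
        rw [Bool.not_eq_true] at hcon
        have hz := (zOf_mem_Sol_negSys_iff (forms_clOf_subset N S) σ).2 hcon
        have hz' : zOf N σ ∈ falsN N (clOf N S) := hz
        rw [falsN_clOf N hSflat] at hz'
        have := (zOf_mem_Sol_negSys_iff (forms_toLinClause_subset hNφ hc) σ).1 (hSF hz')
        rw [hσ] at this
        exact Bool.noConfusion this
      have hρ₂ := isResLinDerivation_append_step hρ₁ h₂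
      refine ⟨ρ ++ [l₁] ++ [l₂], hρ₂, ?_, ?_⟩
      · intro S' hS'
        rcases List.mem_cons.1 hS' with rfl | hS'
        · refine ⟨ρ.length + 1, by simp, ?_⟩
          rw [List.getElem_append_right (by simp)]
          simp [l₂]
        · rw [List.append_assoc]
          exact hold _ S' hS'
      · intro l hl
        simp only [List.append_assoc, List.mem_append, List.mem_cons, List.not_mem_nil,
          or_false] at hl
        rcases hl with hl | rfl | rfl
        · exact hrk l hl
        · -- the initial clause has rank ≤ t
          refine le_max_of_le_right ((linClauseRank_le_card _).trans ?_)
          refine le_trans ?_ (hφ c hc)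
          rw [show l₁.clause = Clause.toLinClause c from rfl, Clause.toLinClause]
          exact (List.toFinset_card_le _).trans (by simp)
        · exact le_max_of_le_left (hSrank.trans (Nat.le_succ _))
    | split θ P Q hP hQ h0 h1 =>
      obtain ⟨iP, hiP, hclP⟩ := hidx P hP
      obtain ⟨iQ, hiQ, hclQ⟩ := hidx Q hQ
      have hPflat : IsFlat P := hflat P (List.mem_cons_of_mem _ hP)
      have hQflat : IsFlat Q := hflat Q (List.mem_cons_of_mem _ hQ)
      set f : Finset ℕ := suppOf N θ.1 with hf
      have hfN : f ⊆ N := suppOf_subset N _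
      -- which earlier line backs which premise
      have h2 : ∀ a : ZMod 2, a = 0 ∨ a = 1 := by decide
      have hθcases : (eqOf N (f, false) = θ ∧ eqOf N (f, true) = θ + one) ∨
          (eqOf N (f, true) = θ ∧ eqOf N (f, false) = θ + one) := by
        rcases h2 θ.2 with h | h
        · right
          constructor
          · ext1 <;> simp [eqOf, hf, restrictN_linFormVec_suppOf, h]
          · ext1 <;> simp [eqOf, one, hf, restrictN_linFormVec_suppOf, h]
        · left
          constructor
          · ext1 <;> simp [eqOf, hf, restrictN_linFormVec_suppOf, h]
          · ext1
            · simp [eqOf, one, hf, restrictN_linFormVec_suppOf]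
            · simp only [eqOf, one, Prod.snd_add, h]; decide
      -- indices backing the (f=0)-premise `X` and the (f=1)-premise `Y`
      obtain ⟨iX, hiX, SX, hSXflat, hclX, hX, iY, hiY, SY, hSYflat, hclY, hY⟩ :
          ∃ iX, ∃ hiX : iX < ρ.length, ∃ SX, IsFlat SX ∧ (ρ[iX]'hiX).clause = clOf N SX ∧
            S ∩ hyp (eqOf N (f, false)) ⊆ SX ∧
          ∃ iY, ∃ hiY : iY < ρ.length, ∃ SY, IsFlat SY ∧ (ρ[iY]'hiY).clause = clOf N SY ∧
            S ∩ hyp (eqOf N (f, true)) ⊆ SY := by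
        rcases hθcases with ⟨hF, hT⟩ | ⟨hT, hF⟩
        · exact ⟨iP, hiP, P, hPflat, hclP, by rw [hF]; exact h0, iQ, hiQ, Q, hQflat, hclQ,
            by rw [hT]; exact h1⟩
        · exact ⟨iQ, hiQ, Q, hQflat, hclQ, by rw [hF]; exact h1, iP, hiP, P, hPflat, hclP,
            by rw [hT]; exact h0⟩
      let lX : ResLinLine := ⟨insert (f, false) (clOf N S), .weaken iX⟩
      let lY : ResLinLine := ⟨insert (f, true) (clOf N S), .weaken iY⟩
      let lS : ResLinLine := ⟨clOf N S, .resolve ρ.length (ρ.length + 1) f⟩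
      have hvX : IsValidResLinLine φ ρ lX := by
        refine IsValidResLinLine.of_weaken rfl hiX fun σ hσ => ?_
        rw [hclX] at hσ
        exact imp_insert_clOf N hSflat hSXflat (f, false) hfN hX σ hσ
      have hρX := isResLinDerivation_append_step hρ hvX
      have hvY : IsValidResLinLine φ (ρ ++ [lX]) lY := by
        refine IsValidResLinLine.of_weaken rfl (by rw [List.length_append]; omega) fun σ hσ => ?_
        rw [List.getElem_append_left hiY, hclY] at hσ
        exact imp_insert_clOf N hSflat hSYflat (f, true) hfN hY σ hσ
      have hρY := isResLinDerivation_append_step hρX hvY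
      have hvS : IsValidResLinLine φ (ρ ++ [lX] ++ [lY]) lS := by
        refine IsValidResLinLine.of_resolve rfl (by simp) (by simp) (C := clOf N S) (D := clOf N S)
          ?_ ?_ (by simp [lS])
        · rw [List.getElem_append_left (by simp), List.getElem_append_right le_rfl]
          simp [lX]
        · rw [List.getElem_append_right (by simp)]
          simp [lY]
      have hρS := isResLinDerivation_append_step hρY hvS
      refine ⟨ρ ++ [lX] ++ [lY] ++ [lS], hρS, ?_, ?_⟩
      · intro S' hS'
        rcases List.mem_cons.1 hS' with rfl | hS'
        · refine ⟨ρ.length + 2, by simp, ?_⟩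
          rw [List.getElem_append_right (by simp)]
          simp [lS]
        · rw [List.append_assoc, List.append_assoc]
          exact hold _ S' hS'
      · intro l hl
        simp only [List.append_assoc, List.mem_append, List.mem_cons, List.not_mem_nil,
          or_false] at hl
        have hins : ∀ lit, linClauseRank (insert lit (clOf N S)) ≤ w + 1 := fun lit =>
          (linClauseRank_le_card _).trans ((Finset.card_insert_le _ _).trans
            (Nat.succ_le_succ ((card_clOf_le N S).trans (by
              have := hrank S List.mem_cons_self
              rwa [codim, W_univ, finrank_bot, Nat.sub_zero] at this))))
        rcases hl with hl | rfl | rfl | rfl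
        · exact hrk l hl
        · exact le_max_of_le_left (hins _)
        · exact le_max_of_le_left (hins _)
        · exact le_max_of_le_left (hSrank.trans (Nat.le_succ _))

/-- **A semantic refutation inside `univ` yields a Res(⊕) refutation** of rank-width
`≤ max (width + 1) t`. -/
theorem exists_refutation_of_isRef {φ : CNF ℕ} {t : ℕ} (hφ : φ.IsWidthLE t) (hNφ : cnfVars φ ⊆ N)
    {L : List (Set (↥N → ZMod 2))} (hL : IsRef (axiomFlats N φ) Set.univ L) :
    ∃ π : List ResLinLine, IsResLinRefutation φ π ∧ resLinWidth π ≤ max (width Set.univ L + 1) t := by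
  classical
  -- drop the empty lines
  have hL' := isRef_restrict hL isFlat_univ Set.Subset.rfl ⟨0, Set.mem_univ _⟩
  set L' := restrict Set.univ L with hL'def
  have hne : ∀ S ∈ L', S.Nonempty := fun S hS => by
    obtain ⟨M, -, -, h⟩ := mem_restrict_iff.1 hS
    exact h
  have hrank : ∀ S ∈ L', codim Set.univ S ≤ width Set.univ L := by
    intro S hS
    obtain ⟨M, hM, hMS, hSne⟩ := mem_restrict_iff.1 hS
    rw [Set.inter_univ] at hMS
    subst hMS
    exact codim_le_width hM hSne
  obtain ⟨ρ, hρ, hidx, hrk⟩ := exists_derivation_of_isDeriv N hφ hNφ L' hL'.deriv hL'.flat hne hrank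
  refine ⟨ρ, ⟨hρ, ?_⟩, resLinWidth_le_iff.2 hrk⟩
  obtain ⟨i, hi, hcl⟩ := hidx Set.univ hL'.root
  refine ⟨ρ[i], List.getElem_mem hi, ?_⟩
  rw [hcl, ← Finset.card_eq_zero]
  have := card_clOf_le N (Set.univ : Set (↥N → ZMod 2))
  rw [W_univ, finrank_bot] at this
  exact Nat.le_zero.1 this

/-! ### The quadratic size–width law for Res(⊕) -/

/-- **Quadratic size–width law for Res(⊕) (sequence form).** For a CNF `φ` of clause width
`≤ t`: if every Res(⊕) refutation of `φ` (Itsykson–Sokolov's system with semantic weakening) has a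
line of rank `≥ k`, then every Res(⊕) refutation of `φ` has at least `B t (k-1) = 1 + Σ_{s=t+1}^{k-1} s`
lines.  (The semantic law `B_le_length` on the window of `φ` and `π`; `k - 1` because a semantic
refutation of width `w` only yields a Res(⊕) refutation of rank-width `≤ w + 1`.) -/
theorem B_le_length_of_isResLinRefutation {φ : CNF ℕ} {t k : ℕ} (hφ : φ.IsWidthLE t)
    (hk : ∀ π, IsResLinRefutation φ π → k ≤ resLinWidth π) {π : List ResLinLine}
    (hπ : IsResLinRefutation φ π) : B t (k - 1) ≤ π.length := by
  classical
  by_cases hkt : k - 1 ≤ t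
  · rw [B_of_le hkt]
    obtain ⟨l, hl, -⟩ := hπ.2
    exact List.length_pos_of_mem hl
  -- the window
  let N : Finset ℕ := piVars π ∪ cnfVars φ
  have hNπ : ∀ l ∈ π, ∀ lit ∈ l.clause, lit.1 ⊆ N :=
    fun l hl lit hlit => (subset_piVars hl hlit).trans Finset.subset_union_left
  have hNφ : cnfVars φ ⊆ N := Finset.subset_union_right
  -- every semantic refutation inside univ has width ≥ k - 1
  have hK : ∀ L, IsRef (axiomFlats N φ) Set.univ L → k - 1 ≤ width Set.univ L := by
    intro L hL
    obtain ⟨π', hπ', hw⟩ := exists_refutation_of_isRef N hφ hNφ hL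
    have := (hk π' hπ').trans hw
    rw [le_max_iff] at this
    omega
  have hsem := isRef_semOf N hπ hNπ
  have h := B_le_length (𝒞 := axiomFlats N φ) (t := t) (finrank (ZMod 2) (Eqn ↥N)) Set.univ
    isFlat_univ ⟨0, Set.mem_univ _⟩ (by omega) (goodAxioms_axiomFlats N hφ) (k - 1) hK
    (semOf N π) hsem
  rwa [length_semOf] at h

/-- **Quadratic size–width law, closed form.** Under the same hypotheses with `t + 1 ≤ k`:
`2 · |π| ≥ 2 + (k-1)·k - t·(t+1)`, i.e. `|π| > ((k-1)k - t(t+1))/2`. -/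
theorem quadratic_le_length_of_isResLinRefutation {φ : CNF ℕ} {t k : ℕ} (hφ : φ.IsWidthLE t)
    (hk : ∀ π, IsResLinRefutation φ π → k ≤ resLinWidth π) (hkt : t + 1 ≤ k)
    {π : List ResLinLine} (hπ : IsResLinRefutation φ π) :
    2 + (k - 1) * k ≤ 2 * π.length + t * (t + 1) := by
  have hB := B_le_length_of_isResLinRefutation hφ hk hπ
  have hcl := two_mul_B (t := t) (K := k - 1) (by omega)
  have hk1 : k - 1 + 1 = k := by omega
  rw [hk1] at hcl
  omega

/-- The law in the tree's `ℕ∞` vocabulary: `k ≤ minResLinWidth φ` implies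
`B t (k-1) ≤ minResLinRefutationSize φ`. -/
theorem B_le_minResLinRefutationSize {φ : CNF ℕ} {t k : ℕ} (hφ : φ.IsWidthLE t)
    (hk : (k : ℕ∞) ≤ minResLinWidth φ) :
    ((B t (k - 1) : ℕ) : ℕ∞) ≤ minResLinRefutationSize φ := by
  have hk' := le_minResLinWidth_iff.1 hk
  unfold minResLinRefutationSize
  refine le_iInf₂ fun π hπ => ?_
  exact_mod_cast B_le_length_of_isResLinRefutation hφ hk' hπ

end Bridge

end ResLinSW
section Corollaries

open Filter Literature.Computability.Complexity Literature.Computability.MetaComplexity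
open scoped Topology

/-- **The crux `ResLinSizeFromWidth` at exponent one.** For all `t` and `m ≥ 1` there is `N₀` such
that for every `N ≥ N₀` and every CNF `φ` of clause width `≤ t` (on `≤ N` variables): if every
Res(⊕) refutation `π` of `φ` has `N ≤ m · resLinWidth π`, then every Res(⊕) refutation of `φ` has
more than `N = N^1` lines.  (Quadratic size–width law with `k = ⌊N/m⌋`.) -/
theorem resLinSizeFromWidth_exponent_one :
    ∀ t m : ℕ, 0 < m → ∃ N₀ : ℕ, ∀ N : ℕ, N₀ ≤ N → ∀ φ : CNF ℕ, φ.IsWidthLE t → φ.numVars ≤ N →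
      (∀ π : List ResLinLine, IsResLinRefutation φ π → N ≤ m * resLinWidth π) →
      ∀ π : List ResLinLine, IsResLinRefutation φ π → N ^ 1 < π.length := by
  intro t m hm
  refine ⟨m * (2 * m + t + 3), fun N hN φ hφ _ hwidth π hπ => ?_⟩
  rw [pow_one]
  -- k = ⌊N/m⌋ bounds every rank-width from below
  set k := N / m with hk
  have hkw : ∀ π', IsResLinRefutation φ π' → k ≤ resLinWidth π' := by
    intro π' hπ'
    have h := hwidth π' hπ'
    rw [hk]
    calc N / m ≤ (m * resLinWidth π') / m := Nat.div_le_div_right h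
      _ = resLinWidth π' := by rw [Nat.mul_div_cancel_left _ hm]
  have hkge : 2 * m + t + 3 ≤ k := by
    rw [hk, Nat.le_div_iff_mul_le hm]
    rw [mul_comm] at hN
    exact hN
  have hNlt : N < m * k + m := by
    have := Nat.lt_div_mul_add (a := N) hm
    rw [← hk] at this
    linarith [mul_comm k m]
  have hq := ResLinSW.quadratic_le_length_of_isResLinRefutation hφ hkw (by omega) hπ
  -- arithmetic: (k-1)·k dominates 2(mk + m) + t(t+1)
  set K := k - 1 with hK
  have hkK : k = K + 1 := by omega
  rw [hkK] at hq hNlt hkge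
  have h1 : K * (2 * m + t + 3) ≤ K * (K + 1) := Nat.mul_le_mul_left K (by omega)
  have h2 : (2 * m + t + 2) * (t + 3) ≤ K * (t + 3) := Nat.mul_le_mul_right _ (by omega)
  nlinarith [h1, h2]

/-- **Random 3-CNFs need quadratic-size Res(⊕) refutations whp**: for `c ≥ 6` there is `δ > 0`
with `Pr_{φ ∼ F₃(n, cn)}[φ unsat ∧ every Res(⊕) refutation π of φ has δ·n² ≤ |π|] → 1` (rank-width
`> δ₀ n` whp by `randomThreeCnf_resLinRank_linear`, width `3`, the quadratic law; `δ = δ₀²/8`). -/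
theorem randomThreeCnf_resLinSize_quadratic (c : ℕ) (hc : 6 ≤ c) :
    ∃ δ : ℝ, 0 < δ ∧ Tendsto (fun n : ℕ => (randomKCNF 3 n (c * n)).toOuterMeasure
      {φ | ¬ CNF.Satisfiable φ ∧ ∀ π : List ResLinLine, IsResLinRefutation φ π →
        δ * (n : ℝ) ^ 2 ≤ (π.length : ℝ)}) atTop (𝓝 1) := by
  obtain ⟨δ₀, hδ₀, hlim⟩ := randomThreeCnf_resLinRank_linear c hc
  refine ⟨δ₀ ^ 2 / 8, by positivity, ?_⟩
  -- width 3 inside the support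
  have hwidth : ∀ {n m : ℕ} {φ : CNF ℕ}, φ ∈ (randomKCNF 3 n m).support → φ.IsWidthLE 3 := by
    intro n m φ hφ cl hcl
    exact (length_of_mem_kClauses (forall_mem_of_mem_support_randomKCNF hφ cl hcl)).le
  -- eventually the rank event (within the support) lies inside the size event
  have hev : ∀ᶠ n : ℕ in atTop,
      (randomKCNF 3 n (c * n)).toOuterMeasure
          {φ | ¬ CNF.Satisfiable φ ∧ ∀ π : List ResLinLine, IsResLinRefutation φ π →
            δ₀ * n < (resLinWidth π : ℝ)} ≤
        (randomKCNF 3 n (c * n)).toOuterMeasure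
          {φ | ¬ CNF.Satisfiable φ ∧ ∀ π : List ResLinLine, IsResLinRefutation φ π →
            δ₀ ^ 2 / 8 * (n : ℝ) ^ 2 ≤ (π.length : ℝ)} := by
    refine eventually_atTop.2 ⟨⌈8 / δ₀⌉₊, fun n hn => ?_⟩
    have hn8 : 8 ≤ δ₀ * n := by
      have h1 : (⌈8 / δ₀⌉₊ : ℝ) ≤ n := by exact_mod_cast hn
      have h2 : 8 / δ₀ ≤ n := (Nat.le_ceil _).trans h1
      rw [div_le_iff₀ hδ₀] at h2
      linarith
    refine PMF.toOuterMeasure_mono _ ?_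
    rintro φ ⟨⟨hns, hrank⟩, hsupp⟩
    refine ⟨hns, fun π hπ => ?_⟩
    have hφ3 : φ.IsWidthLE 3 := hwidth hsupp
    -- k = ⌊δ₀ n⌋ + 1 bounds every rank-width from below
    set k : ℕ := ⌊δ₀ * n⌋₊ + 1 with hk
    have hkw : ∀ π', IsResLinRefutation φ π' → k ≤ resLinWidth π' := by
      intro π' hπ'
      have h := hrank π' hπ'
      have : (⌊δ₀ * n⌋₊ : ℝ) < resLinWidth π' := (Nat.floor_le (by positivity)).trans_lt h
      have : ⌊δ₀ * n⌋₊ < resLinWidth π' := by exact_mod_cast this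
      omega
    have hk5 : 3 + 1 ≤ k := by
      have : (4 : ℝ) ≤ ⌊δ₀ * n⌋₊ := by
        have := Nat.lt_floor_add_one (δ₀ * n)
        have h4 : (4 : ℕ) ≤ ⌊δ₀ * n⌋₊ := Nat.le_floor (by push_cast; linarith)
        exact_mod_cast h4
      have : (4 : ℕ) ≤ ⌊δ₀ * n⌋₊ := by exact_mod_cast this
      omega
    have hq := ResLinSW.quadratic_le_length_of_isResLinRefutation hφ3 hkw hk5 hπ
    -- real arithmetic: (k-1) k ≥ (δ₀ n - 1) δ₀ n ≥ δ₀² n² / 2, and 2|π| ≥ (k-1)k - 10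
    have hkR : δ₀ * n ≤ (k : ℝ) := by
      rw [hk]; push_cast
      exact (Nat.lt_floor_add_one _).le
    have hk1R : δ₀ * n - 1 ≤ ((k - 1 : ℕ) : ℝ) := by
      have : ((k - 1 : ℕ) : ℝ) = (k : ℝ) - 1 := by
        rw [Nat.cast_sub (by omega)]; simp
      rw [this]; linarith
    have hqR : (2 : ℝ) + ((k - 1 : ℕ) : ℝ) * k ≤ 2 * π.length + 3 * (3 + 1) := by exact_mod_cast hq
    have hprod : (δ₀ * n - 1) * (δ₀ * n) ≤ ((k - 1 : ℕ) : ℝ) * k :=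
      mul_le_mul hk1R hkR (by positivity) (Nat.cast_nonneg _)
    have hhalf : δ₀ * n / 2 ≤ δ₀ * n - 1 := by linarith
    nlinarith [hprod, hhalf, hqR, mul_nonneg (by positivity : (0:ℝ) ≤ δ₀ * n / 2) (by positivity : (0 : ℝ) ≤ δ₀ * n)]
  refine tendsto_of_tendsto_of_tendsto_of_le_of_le' hlim tendsto_const_nhds hev
    (Eventually.of_forall fun n => ?_)
  exact (MeasureTheory.measure_mono (Set.subset_univ _)).trans_eq
    ((PMF.toOuterMeasure_apply_eq_one_iff _ _).2 (Set.subset_univ _))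

end Corollaries

end Summit.PneNP.PneNP.Theorems
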